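import Summits.Ventures.HSemireg.S4BridgeSplitPointReach
import Summits.HodgeConjecture.HodgeConjecture.Theorems.Ring2HypothesesWeilComponents
import Literature.AlgebraicGeometry.HodgeTheory.WeilClassesTensorPointAlgebraic
import Literature.AlgebraicGeometry.HodgeTheory.WeilClassesSixfoldsProofs
import Literature.AlgebraicGeometry.Motives.AbelianVarietyPoincareSplitting
import Literature.AlgebraicGeometry.Motives.AbelianVarietyCohomologyExteriorH1
import Literature.AlgebraicGeometry.Motives.TateAbelianFiniteLatticeProofs
import Literature.NumberTheory.DiophantineGeometry.AVIsogenyFlat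
import HarnessLib

/-!
# Venture HSemireg — S4-PUSH bridge junction (B1) ∘ (B2⁺): fibrewise algebraicity of the Weil planes of ONE
# period-surjective family through the product point ⟹ ring 2's class target `WeilClassesComponent n d δ`
# (Markman, arXiv:2509.23403 §11.5 Step 1: «isogenous» ⟹ algebraicity transfers; van Geemen 3.6–3.7)

HONEST FRAMING. Bridge-typing file of the computation cell `pub-hsemireg` (track «S4-PUSH» (iii), seat s4-bridge-2;
`run/shared/lean/pub/pub-hsemireg/s4push/B2-TYPING-s4-bridge-2.md` §13). Nothing here bears on any case of the Hodge
conjecture; no object of the cell is certified; HC / HC_CM / HC_AV are NOT proved; `WeilClassesComponent n d δ` is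
ring 2's OPEN class target and appears below only as the CONCLUSION of implications. This file is pure COMPOSITION of
tree theorems (no new mathematics): it is the Lean form of the junction between the two bridge lanes of the cell —
(B1) «a VHC / semiregularity door makes the transported Weil classes algebraic along ONE connected family» and
(B2⁺) «the product point of the discriminant class `(n, d, δ)` reaches every member of the class up to `K`-isogeny
through any period-surjective family» (`S4BridgeSplitPointReach.lean`) — landing in the class-indexed target of
`Summits/HodgeConjecture/HodgeConjecture/Theorems/Ring2HypothesesWeilComponents.lean`. The composition was drafted
and machine-checked by theory seat th-3 g22 (`run/shared/lean/pub/pub-hsemireg/theory/th3/b2read/B2GlueCheck.lean.txt`,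
sha256/16 `5cd748ee3abac55e`; read file `theory/TH3-B2PLUS-REACH-READ.md` §3) and is filed here by s4-bridge-2 g9 with
the statements of (J2) and (J) byte-identical to that check (namespace renamed) plus the corollary (J′); th-3 g22's own
filing of the same leaf (p363656, concurrent, bounced append-only behind p363633) contributed the arbitrary-member form (J″),
merged below verbatim (rev. 2, s4-bridge-2 g9).

## What is proved (0 sorry; all hypotheses BY NAME; [F] and [U] verbatim those of `S4BridgeSplitPointReach.lean`)

* (J2) `weilClassesOf_le_algebraicClasses_of_isIsogeny_of_comm` — **algebraicity of the WHOLE Weil plane passes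
  forward along a `K`-linear isogeny**: `u : Y ⟶ A` an isogeny of abelian `2n`-folds with `u ≫ φ = Ψ ≫ u` and
  `weilClassesOf Y Ψ n d ≤ algebraicClasses` ⟹ `weilClassesOf A φ n d ≤ algebraicClasses`. Kernel: the
  quasi-inverse `v` (`u ≫ v = m`, `v ≫ u = m`, `m ≥ 1`; `AbelianVariety.IsIsogeny.exists_nsmul_inverse_holds`) is an
  isogeny, hence flat (`AbelianVariety.IsIsogeny.flat`), and the tree's
  `HodgeTheory.weilClassesOf_le_algebraicClasses_of_isogenyPair` (van Geemen 3.6–3.7; Milne 1986 §8 Prop. 8.1)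
  applies to the pair `(v, u)`. (The tree's `exists_isogenyPair_of_isIsogeny_of_comm` is the OTHER orientation.)
* (J) `weilClassesComponent_of_splitPointReach_of_fibrewise` — **the junction, plane form**: granted [F], for
  `n, d ≥ 1` and `sign δ = (-1)ⁿ`, the product point `(P, ψ, h_P)` of (B2⁺) (same `∃`-prefix, verbatim) has: for
  EVERY family `(Y_s, Ψ_s)_{s ∈ S}` of abelian `2n`-folds that is period-surjective at `(P, ψ, h_P)` ([U], verbatim),
  `(∀ s, weilClassesOf (Y s) (Ψ s) n d ≤ algebraicClasses (Y s).X n) → Ring2.Hypotheses.WeilClassesComponent n d δ`.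
  Kernel: a member's rational `(n,n)` Weil class `c` is `0` (algebraic) or makes `(A, φ)` of Weil type
  (`isWeilType_of_weilClass_ne_zero`, Deligne–Milne Prop. 4.4 ⇒), whereupon (B2⁺) gives `u : Y_s ⟶ A` and (J2)
  transfers.
* (J′) `weilClassesComponent_of_splitPointReach_of_fibrewise_exists_ne_zero` — **the junction, one-class form**
  (what a (B1) door outputs at class level): the same with the fibrewise hypothesis weakened to «`Ψ_s ≫ Ψ_s = -d` and
  the Weil plane of every fibre contains ONE non-zero algebraic class»; the plane follows fibrewise from the tree's
  `weilClassesOf_le_algebraicClasses_of_exists_ne_zero` (van Geemen, proof of Thm. 6.12: the `(x·𝟙 + y·φ)^*`-translates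
  and complex conjugation), fed with `H•(Y_s(ℂ)) = ⋀• H¹` (`AbelianVariety.hasExteriorCohomologyH1_complexPoints`) and
  `b₁ = 4n`.
* (J″) `weilClassesComponent_of_memberReach_of_fibrewise` — **the junction through an ARBITRARY member, plane form**
  (th-3 g22): as (J) with the period-surjective family taken through ANY member `(P, ψ, h_P)` of Weil type `(n, d)` of
  the class instead of the product point (from the component-free (B2⁺) `member_reaches_member_of_periodSurjective`);
  e.g. through a hyperbolic member when `δ` is the split class.

READING: «if a (B1) door makes the Weil planes (equivalently: one non-zero Weil class each) of the fibres of ONE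
period-surjective family of `K`-abelian `2n`-folds through the product point of `(n, d, δ)` algebraic, then — granted
Riemann's theorem [F] — every rational `(n,n)` Weil class of every polarized member `(A, φ, h_A)` of the discriminant
class `(n, d, δ)` is algebraic», i.e. ring 2's `WeilClassesComponent n d δ`; downstream, ring 2 already turns
`WeilClassesComponent` / `WeilClassesByComponent` into its ladder rows (parts VII-A/B). This is Markman's §11.5 Step 1
for an ARBITRARY class, with Deligne's family replaced by the hypothesis [U].

## AS PRINTED — citation record

* E. Markman, *Secant sheaves and Weil classes on abelian varieties*, arXiv:2509.23403 (2025, survey; UNREFEREED),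
  §11.5 Step 1 (public PDF p. 21; held chunk p0019 L18–22), verbatim: «The abelian variety `A` is isogenous to
  `X × X̂` and is thus endowed with the embedding `η : K → End_{Hdg}(H¹(X × X̂)) ≅ End_{Hdg}(H¹(A, ℚ))` and the
  polarization `Ξ_t` … This completes the implementation of the strategy for the proof of algebraicity of the Weil
  classes on all deformations of `(A, η, Ξ_t)`, and hence also for all deformations of `(X × X̂, η, Ξ_t)` … Two connected
  components of the moduli space of polarized abelian varieties of Weil type of dimension `2n`, the same imaginary
  quadratic number field, and the same discriminant, parametrize isogenous abelian varieties [van-Geemen]. … We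
  conclude that the Hodge Weil classes on all polarized abelian sixfolds of split Weil type are algebraic.» What the
  print USES and does not spell out — that algebraicity of the Weil classes passes between `K`-isogenous members — is
  (J2); typed here for every class `δ` ⊇ printed (the split class), named, not silent («typed for every class»).
  [cite: Markman2025SurveySecant, §11.5 Step 1 (p. 21)]
* B. van Geemen, *An introduction to the Hodge conjecture for abelian varieties*, LNM 1594 (1994): 3.6–3.7 (pull-back
  and isogenies on the cohomology of abelian varieties — the kernel of `weilClassesOf_le_algebraicClasses_of_isogenyPair`),
  proof of Thm. 6.12 (one class ⟹ the plane), 4.10 / Lemma 5.2 (Weil type ⟺ the Weil space consists of Hodge classes).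
  [cite: vanGeemen1994HodgeAV, 3.6–3.7, 4.10, Lemma 5.2 and proof of Thm. 6.12]
* P. Deligne (notes by J. S. Milne), *Hodge cycles on abelian varieties*, LNM 900 (1982), §4 Prop. 4.4 (a non-zero Weil
  class of type `(n, n)` forces `a_σ = b_σ = n`) — in the tree as `isWeilType_of_weilClass_ne_zero`; proof of Thm. 4.8
  (the family; here the hypothesis [U], see `S4BridgeSplitPointReach.lean`). [cite: Deligne1982HodgeCycles, §4 Prop. 4.4 and proof of Thm. 4.8]
* J. S. Milne, *Abelian varieties* (1986), §8 Prop. 8.1 (isogenies are finite flat; inherited citation of the kernel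
  lemma). [cite: Milne1986AbelianVarieties, §8 Prop. 8.1]
* Riemann's theorem [F]: as in `S4BridgeSplitPointReach.lean`. [cite: Lange2023AbelianVarietiesComplex, Thm. 2.1.13, Cor. 2.1.17]

## Rendering and scope (readings NAMED; referee protocol §3 (B2) traps honoured)

* The junction CONSUMES, it does not construct: (J1) the ONE family that is simultaneously (B1)-admissible (smooth
  projective over a smooth irreducible base, global `K`-action, flat Weil section — ring 2's `HasWeilChartsOfDisc` /
  th-3's `SweepsClasses`) AND period-surjective [U] at the product point is Deligne's `Γ∖B → Γ∖X⁺` (proof of Thm. 4.8;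
  van Geemen 5.5) and is NOT built in the tree — it stays the hypothesis [U] plus the (B1) lane's family binder; a (B1)
  door's output enters only through the fibrewise hypothesis `halg` / `hex`. (J3) «plane from one class» is discharged
  in (J′) by a tree theorem; what (J′) still asks of the (B1) side is a NON-ZERO algebraic Weil class on every fibre.
* «Reaches» = `K`-linear ISOGENY from a fibre (trap (iii): isogenous, not isomorphic); member wrinkle: (B2⁺) quantifies
  over members of Weil type, the class target over all `(A, φ, h_A)` with `φ² = -d` — no gap, a member carrying a
  non-zero rational `(n,n)` Weil class IS of Weil type (th-3 P1). Typed weaker-or-equal than any sentence asserting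
  `WeilClassesComponent n d δ` outright: every theorem below is an implication from [F], [U] and a fibrewise input.
-/

noncomputable section

open CategoryTheory AlgebraicGeometry
open scoped TensorProduct
open Literature.AlgebraicGeometry Literature.AlgebraicGeometry.Motives
open Literature.AlgebraicGeometry.HodgeTheory
open Literature.AlgebraicGeometry.VanGeemen1994
open Literature.AlgebraicTopology.SingularHomology
open Summit.HodgeConjecture.HodgeConjecture.Ring2.AbelianAll

namespace Summit.Ventures.HSemireg

/-- (J2) **A `K`-linear isogeny FROM a variety with algebraic Weil plane transfers algebraicity of the whole Weil
plane** (the step Markman's §11.5 Step 1 uses between «isogenous» members; van Geemen 3.6–3.7): `u : Y ⟶ A` an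
isogeny of abelian `2n`-folds with `u ≫ φ = Ψ ≫ u`; the quasi-inverse `v` (`u ≫ v = m`, `v ≫ u = m`, `m ≥ 1`) is an
isogeny, hence flat, and `HodgeTheory.weilClassesOf_le_algebraicClasses_of_isogenyPair` applies to the pair `(v, u)`.
Statement byte-identical to th-3 g22's check file `B2GlueCheck.lean.txt` (5cd748ee3abac55e).
[cite: Markman2025SurveySecant, §11.5 Step 1 (p. 21)] [cite: vanGeemen1994HodgeAV, 3.6–3.7]
[cite: Milne1986AbelianVarieties, §8 Prop. 8.1] -/
theorem weilClassesOf_le_algebraicClasses_of_isIsogeny_of_comm {Y A : AbelianVariety ℂ} {n d : ℕ}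
    {Ψ : Y ⟶ Y} {φ : A ⟶ A} (hY : Y.dim = 2 * n) (hA : A.dim = 2 * n)
    {u : Y ⟶ A} (hu : AbelianVariety.IsIsogeny u) (hcomm : u ≫ φ = Ψ ≫ u)
    (halg : weilClassesOf Y Ψ n d ≤ algebraicClasses Y.X n) :
    weilClassesOf A φ n d ≤ algebraicClasses A.X n := by
  obtain ⟨v, m, hm, huv, hvu⟩ := AbelianVariety.IsIsogeny.exists_nsmul_inverse_holds hu
  -- the quasi-inverse is an isogeny: `u ≫ v = m`, `v ≫ u = m` are isogenies
  have hv : AbelianVariety.IsIsogeny v :=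
    AbelianVariety.isIsogeny_of_comp_eq_of_comp_eq (AbelianVariety.isIsogeny_nsmul_id_of_ne_zero Y hm.ne')
      (AbelianVariety.isIsogeny_nsmul_id_of_ne_zero A hm.ne') huv hvu
  haveI : Flat v.hom.hom.hom.left := AbelianVariety.IsIsogeny.flat hv
  exact weilClassesOf_le_algebraicClasses_of_isogenyPair (Motives.isSmoothProjective_of_dim_eq' hA)
    (Motives.isSmoothProjective_of_dim_eq' hY) v u hcomm hm hvu halg

/-- (J) **The junction (B1) ∘ (B2⁺) ⟹ ring 2's class target, PLANE form, modulo [F]**: for `n, d ≥ 1` and a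
right-sign class `δ` (`weilSign d δ = (-1)ⁿ`), the product point `(P, ψ, h_P)` of (B2⁺)
(`splitPoint_reaches_component_of_periodSurjective`; same `∃`-prefix: CM elliptic curve `(E₀, ψ₀)`,
`IsCMProductPoint E₀ ψ₀ P ψ`, `IsWeilType P ψ n d`, `HasWeilDiscriminantNondeg P ψ n d h_P δ` with
`h_P = d·e^*a + ψ^*e^*a`) has the property that for EVERY family `(Y_s, Ψ_s)_{s ∈ S}` of abelian `2n`-folds which is
period-surjective at `(P, ψ, h_P)` ([U], verbatim the `hU` of the reach files), algebraicity of the Weil PLANES of all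
fibres implies `Ring2.Hypotheses.WeilClassesComponent n d δ` — every rational `(n,n)` Weil class of every polarized
member `(A, φ, h_A)` of the class `(n, d, δ)` is algebraic: such a class `c` is `0` or makes `(A, φ)` of Weil type
(`isWeilType_of_weilClass_ne_zero`, Deligne–Milne Prop. 4.4), so (B2⁺) gives a `K`-linear isogeny `u : Y_s ⟶ A`
(«isogenous», Markman §11.5 Step 1 [van-Geemen]) and (J2) transfers. The family is NOT constructed (hypothesis [U] =
existence of Deligne's family at the product point, proof of Thm. 4.8); typed for every class `δ` ⊇ printed (split
class). Statement byte-identical to th-3 g22's check file `B2GlueCheck.lean.txt` (5cd748ee3abac55e).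
[cite: Markman2025SurveySecant, §11.5 Step 1 (p. 21)] [cite: Deligne1982HodgeCycles, §4 Prop. 4.4 and proof of Thm. 4.8]
[cite: vanGeemen1994HodgeAV, 3.6–3.7, 4.10 and 5.3–5.5]
[cite: Lange2023AbelianVarietiesComplex, Thm. 2.1.13, Cor. 2.1.17] -/
theorem weilClassesComponent_of_splitPointReach_of_fibrewise
    (hF : ∀ (A B : AbelianVariety ℂ) (f : bettiCohomology B.X 1 ≃ₗ[ℚ] bettiCohomology A.X 1),
        A.dim = B.dim →
        (∀ x : ℂ ⊗[ℚ] bettiCohomology B.X 1,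
          IsOfHodgeType B.dim B.X 1 1 0 (Motives.ofRatClassBaseChange (ComplexPoints B.X) 1 x) →
          IsOfHodgeType A.dim A.X 1 1 0
            (Motives.ofRatClassBaseChange (ComplexPoints A.X) 1 (f.toLinearMap.baseChange ℂ x))) →
        ∃ (u : A ⟶ B) (k : ℕ), AbelianVariety.IsIsogeny u ∧ 0 < k ∧
          ∀ x, bettiCohomology.map u.hom.hom.hom 1 x = k • f x)
    {n d : ℕ} (hn : 0 < n) (hd : 0 < d) (δ : weilNormResidueGroup d) (hδ : weilSign d δ = (-1) ^ n) :
    ∃ (E₀ : AbelianVariety ℂ) (ψ₀ : E₀ ⟶ E₀) (P : AbelianVariety ℂ) (ψ : P ⟶ P)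
      (e : ProjectiveEmbedding P.X) (a : complexBetti (projectiveSpace e.n ℂ) 2)
      (ha : IsRationalClass a) (ha0 : a ≠ 0),
      E₀.dim = 1 ∧ ψ₀ ≫ ψ₀ = -(d • 𝟙 E₀) ∧ IsCMProductPoint E₀ ψ₀ P ψ ∧ IsWeilType P ψ n d ∧
      HasWeilDiscriminantNondeg P ψ n d
        ((d : ℂ) • complexBetti.map e.ι 2 a + complexBetti.map ψ.hom.hom.hom 2 (complexBetti.map e.ι 2 a)) δ ∧
      ∀ {S : Type} (Y : S → AbelianVariety ℂ) (Ψ : ∀ s, Y s ⟶ Y s), (∀ s, (Y s).dim = 2 * n) →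
        (∃ (m : ℕ) (hm : 1 ≤ m) (hPm : P.dim = m + 1) (hd' : 0 < d) (hψ : ψ ≫ ψ = -(d • 𝟙 P))
            (ω : complexBetti P.X (2 + 2 * m)) (hω : IsRationalClass ω) (hω0 : ω ≠ 0),
            ∀ (J : (weilDatumOfKsymm hm hPm hd' hψ e ha ha0 hω hω0).Cx →ₗ[ℂ]
                (weilDatumOfKsymm hm hPm hd' hψ e ha ha0 hω hω0).Cx)
              (hW : Motives.IsWeilComplexStructure (weilDatumOfKsymm hm hPm hd' hψ e ha ha0 hω hω0).hForm J),
              ∃ (s : S) (β : bettiCohomology P.X 1 ≃ₗ[ℚ] bettiCohomology (Y s).X 1),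
                (∀ x, β (bettiCohomology.map ψ.hom.hom.hom 1 x) =
                  bettiCohomology.map (Ψ s).hom.hom.hom 1 (β x)) ∧
                ∀ x ∈ ((weilDatumOfKsymm hm hPm hd' hψ e ha ha0 hω hω0).hodgeStructure J hW.sq).piece 1 0,
                  IsOfHodgeType (2 * n) (Y s).X 1 1 0
                    (Motives.ofRatClassBaseChange (ComplexPoints (Y s).X) 1 (β.toLinearMap.baseChange ℂ x))) →
        (∀ s, weilClassesOf (Y s) (Ψ s) n d ≤ algebraicClasses (Y s).X n) →
        Summit.HodgeConjecture.HodgeConjecture.Ring2.Hypotheses.WeilClassesComponent n d δ := by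
  obtain ⟨E₀, ψ₀, P, ψ, e, a, ha, ha0, hE, hψ₀, hprod, hWP, hδP, hreach⟩ :=
    splitPoint_reaches_component_of_periodSurjective hF hn hd δ hδ
  refine ⟨E₀, ψ₀, P, ψ, e, a, ha, ha0, hE, hψ₀, hprod, hWP, hδP, ?_⟩
  intro S Y Ψ hY hU halg A φ hAdim _hX hφ eA aA haA haA0 hδA c _hc hcH hcW
  by_cases hc0 : c = 0
  · rw [hc0]; exact Submodule.zero_mem _
  have hWA : IsWeilType A φ n d := isWeilType_of_weilClass_ne_zero hn hd hAdim hφ hcW hc0 hcH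
  obtain ⟨s, u, hu, hcomm⟩ := hreach Y Ψ hY hU A φ eA aA hWA haA haA0 hδA
  exact weilClassesOf_le_algebraicClasses_of_isIsogeny_of_comm (hY s) hAdim hu hcomm (halg s) hcW

/-- (J′) **The junction (B1) ∘ (B2⁺) ⟹ ring 2's class target, ONE-CLASS form, modulo [F]**: as (J), with the
fibrewise input weakened to what a (B1) door outputs at class level — `Ψ_s ≫ Ψ_s = -d` and, on every fibre `Y_s`, ONE
non-zero algebraic class in the Weil plane `weilClassesOf (Y s) (Ψ s) n d` (a transported flat Weil section,
Deligne (4.8) (c); the «flat Weil section» conjunct of ring 2's `HasWeilChartsOfDisc`). The whole plane follows on each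
fibre from the tree's `weilClassesOf_le_algebraicClasses_of_exists_ne_zero` (van Geemen, proof of Thm. 6.12), fed with
`H•(Y_s(ℂ); ℂ) = ⋀• H¹` (`AbelianVariety.hasExteriorCohomologyH1_complexPoints`) and `b₁(Y_s) = 4n`
(`AbelianVariety.finrank_complexBetti_one`); then (J). This discharges th-3's residual (J3) «plane from one class» by a
tree theorem; (J1) (the family) remains the hypothesis [U] plus the (B1) lane's family binder.
[cite: vanGeemen1994HodgeAV, proof of Thm. 6.12] [cite: Deligne1982HodgeCycles, §4 Prop. 4.4 and proof of Thm. 4.8]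
[cite: Markman2025SurveySecant, §11.5 Step 1 (p. 21)] -/
theorem weilClassesComponent_of_splitPointReach_of_fibrewise_exists_ne_zero
    (hF : ∀ (A B : AbelianVariety ℂ) (f : bettiCohomology B.X 1 ≃ₗ[ℚ] bettiCohomology A.X 1),
        A.dim = B.dim →
        (∀ x : ℂ ⊗[ℚ] bettiCohomology B.X 1,
          IsOfHodgeType B.dim B.X 1 1 0 (Motives.ofRatClassBaseChange (ComplexPoints B.X) 1 x) →
          IsOfHodgeType A.dim A.X 1 1 0
            (Motives.ofRatClassBaseChange (ComplexPoints A.X) 1 (f.toLinearMap.baseChange ℂ x))) →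
        ∃ (u : A ⟶ B) (k : ℕ), AbelianVariety.IsIsogeny u ∧ 0 < k ∧
          ∀ x, bettiCohomology.map u.hom.hom.hom 1 x = k • f x)
    {n d : ℕ} (hn : 0 < n) (hd : 0 < d) (δ : weilNormResidueGroup d) (hδ : weilSign d δ = (-1) ^ n) :
    ∃ (E₀ : AbelianVariety ℂ) (ψ₀ : E₀ ⟶ E₀) (P : AbelianVariety ℂ) (ψ : P ⟶ P)
      (e : ProjectiveEmbedding P.X) (a : complexBetti (projectiveSpace e.n ℂ) 2)
      (ha : IsRationalClass a) (ha0 : a ≠ 0),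
      E₀.dim = 1 ∧ ψ₀ ≫ ψ₀ = -(d • 𝟙 E₀) ∧ IsCMProductPoint E₀ ψ₀ P ψ ∧ IsWeilType P ψ n d ∧
      HasWeilDiscriminantNondeg P ψ n d
        ((d : ℂ) • complexBetti.map e.ι 2 a + complexBetti.map ψ.hom.hom.hom 2 (complexBetti.map e.ι 2 a)) δ ∧
      ∀ {S : Type} (Y : S → AbelianVariety ℂ) (Ψ : ∀ s, Y s ⟶ Y s), (∀ s, (Y s).dim = 2 * n) →
        (∀ s, Ψ s ≫ Ψ s = -(d • 𝟙 (Y s))) →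
        (∃ (m : ℕ) (hm : 1 ≤ m) (hPm : P.dim = m + 1) (hd' : 0 < d) (hψ : ψ ≫ ψ = -(d • 𝟙 P))
            (ω : complexBetti P.X (2 + 2 * m)) (hω : IsRationalClass ω) (hω0 : ω ≠ 0),
            ∀ (J : (weilDatumOfKsymm hm hPm hd' hψ e ha ha0 hω hω0).Cx →ₗ[ℂ]
                (weilDatumOfKsymm hm hPm hd' hψ e ha ha0 hω hω0).Cx)
              (hW : Motives.IsWeilComplexStructure (weilDatumOfKsymm hm hPm hd' hψ e ha ha0 hω hω0).hForm J),
              ∃ (s : S) (β : bettiCohomology P.X 1 ≃ₗ[ℚ] bettiCohomology (Y s).X 1),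
                (∀ x, β (bettiCohomology.map ψ.hom.hom.hom 1 x) =
                  bettiCohomology.map (Ψ s).hom.hom.hom 1 (β x)) ∧
                ∀ x ∈ ((weilDatumOfKsymm hm hPm hd' hψ e ha ha0 hω hω0).hodgeStructure J hW.sq).piece 1 0,
                  IsOfHodgeType (2 * n) (Y s).X 1 1 0
                    (Motives.ofRatClassBaseChange (ComplexPoints (Y s).X) 1 (β.toLinearMap.baseChange ℂ x))) →
        (∀ s, ∃ c ∈ weilClassesOf (Y s) (Ψ s) n d, c ∈ algebraicClasses (Y s).X n ∧ c ≠ 0) →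
        Summit.HodgeConjecture.HodgeConjecture.Ring2.Hypotheses.WeilClassesComponent n d δ := by
  obtain ⟨E₀, ψ₀, P, ψ, e, a, ha, ha0, hE, hψ₀, hprod, hWP, hδP, hJ⟩ :=
    weilClassesComponent_of_splitPointReach_of_fibrewise hF hn hd δ hδ
  refine ⟨E₀, ψ₀, P, ψ, e, a, ha, ha0, hE, hψ₀, hprod, hWP, hδP, ?_⟩
  intro S Y Ψ hY hΨ hU hex
  refine hJ Y Ψ hY hU fun s ↦ ?_
  -- plane from one class on the fibre `Y_s`: `H• = ⋀• H¹` and `b₁ = 4n`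
  have hb₁ : Module.finrank ℂ (complexBetti (Y s).X 1) = 2 * (2 * n) := by
    rw [AbelianVariety.finrank_complexBetti_one, hY s]
  exact weilClassesOf_le_algebraicClasses_of_exists_ne_zero hn hd (hΨ s)
    (AbelianVariety.hasExteriorCohomologyH1_complexPoints (Y s)) hb₁ (hex s)

/-- (J″) **The junction through an ARBITRARY member, PLANE form, modulo [F]** (theory seat th-3 g22's third theorem,
filed concurrently as p363656 and merged here verbatim; statement and proof th-3's): for a member `(P, ψ, h_P)` of Weil
type `(n, d)` of the class `(n, d, δ)` and ANY family `(Y_s, Ψ_s)` of abelian `2n`-folds with endomorphisms that is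
[U]-period-surjective at it, fibrewise algebraicity of the Weil planes implies `WeilClassesComponent n d δ`, granted [F]
(the component-free (B2⁺) `member_reaches_member_of_periodSurjective` + (J2); the product point plays no role — e.g.
the family may be taken through a hyperbolic member). [cite: Markman2025SurveySecant, §11.5 Step 1 (p. 21)]
[cite: vanGeemen1994HodgeAV, 3.6–3.7 and 5.3–5.5]
[cite: Deligne1982HodgeCycles, §4 Prop. 4.1 and proof of Thm. 4.8 — quadruples (A₁, θ₁, ν₁, k₁) and property (b) (Milne 2003 TeXed ed. pp. 32–35)] -/
theorem weilClassesComponent_of_memberReach_of_fibrewise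
    (hF : ∀ (A B : AbelianVariety ℂ) (f : bettiCohomology B.X 1 ≃ₗ[ℚ] bettiCohomology A.X 1),
        A.dim = B.dim →
        (∀ x : ℂ ⊗[ℚ] bettiCohomology B.X 1,
          IsOfHodgeType B.dim B.X 1 1 0 (Motives.ofRatClassBaseChange (ComplexPoints B.X) 1 x) →
          IsOfHodgeType A.dim A.X 1 1 0
            (Motives.ofRatClassBaseChange (ComplexPoints A.X) 1 (f.toLinearMap.baseChange ℂ x))) →
        ∃ (u : A ⟶ B) (k : ℕ), AbelianVariety.IsIsogeny u ∧ 0 < k ∧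
          ∀ x, bettiCohomology.map u.hom.hom.hom 1 x = k • f x)
    {n d : ℕ} {P : AbelianVariety ℂ} {ψ : P ⟶ P} (hWP : IsWeilType P ψ n d)
    (e : ProjectiveEmbedding P.X) {a : complexBetti (projectiveSpace e.n ℂ) 2} (ha : IsRationalClass a) (ha0 : a ≠ 0)
    {δ : weilNormResidueGroup d}
    (hδP : HasWeilDiscriminantNondeg P ψ n d
      ((d : ℂ) • complexBetti.map e.ι 2 a + complexBetti.map ψ.hom.hom.hom 2 (complexBetti.map e.ι 2 a)) δ)
    {S : Type*} (Y : S → AbelianVariety ℂ) (Ψ : ∀ s, Y s ⟶ Y s) (hY : ∀ s, (Y s).dim = 2 * n)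
    (hU : ∃ (m : ℕ) (hm : 1 ≤ m) (hPm : P.dim = m + 1) (hd' : 0 < d) (hψ : ψ ≫ ψ = -(d • 𝟙 P))
        (ω : complexBetti P.X (2 + 2 * m)) (hω : IsRationalClass ω) (hω0 : ω ≠ 0),
        ∀ (J : (weilDatumOfKsymm hm hPm hd' hψ e ha ha0 hω hω0).Cx →ₗ[ℂ]
            (weilDatumOfKsymm hm hPm hd' hψ e ha ha0 hω hω0).Cx)
          (hW : Motives.IsWeilComplexStructure (weilDatumOfKsymm hm hPm hd' hψ e ha ha0 hω hω0).hForm J),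
          ∃ (s : S) (β : bettiCohomology P.X 1 ≃ₗ[ℚ] bettiCohomology (Y s).X 1),
            (∀ x, β (bettiCohomology.map ψ.hom.hom.hom 1 x) =
              bettiCohomology.map (Ψ s).hom.hom.hom 1 (β x)) ∧
            ∀ x ∈ ((weilDatumOfKsymm hm hPm hd' hψ e ha ha0 hω hω0).hodgeStructure J hW.sq).piece 1 0,
              IsOfHodgeType (2 * n) (Y s).X 1 1 0
                (Motives.ofRatClassBaseChange (ComplexPoints (Y s).X) 1 (β.toLinearMap.baseChange ℂ x)))
    (halg : ∀ s, weilClassesOf (Y s) (Ψ s) n d ≤ algebraicClasses (Y s).X n) :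
    Summit.HodgeConjecture.HodgeConjecture.Ring2.Hypotheses.WeilClassesComponent n d δ := by
  intro A φ hAdim _hX hφ eA aA haA haA0 hδA c _hc hcH hcW
  by_cases hc0 : c = 0
  · rw [hc0]; exact Submodule.zero_mem _
  have hWA : IsWeilType A φ n d := isWeilType_of_weilClass_ne_zero hWP.pos hWP.d_pos hAdim hφ hcW hc0 hcH
  obtain ⟨s, u, hu, hcomm⟩ :=
    member_reaches_member_of_periodSurjective hF hWP e ha ha0 hδP Y Ψ hY hU hWA eA haA haA0 hδA
  exact weilClassesOf_le_algebraicClasses_of_isIsogeny_of_comm (hY s) hAdim hu hcomm (halg s) hcW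

end Summit.Ventures.HSemireg

end
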